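import Summits.BirchSwinnertonDyer.BirchSwinnertonDyer.Theorems.SignedBaseChangeAnticyclotomicEisensteinDivisibilityAdmdefAdmissibleEigenline
import Summits.BirchSwinnertonDyer.BirchSwinnertonDyer.Theorems.SignedBaseChangeAnticyclotomicEisensteinDivisibilityAdmdefBipartitePropagation
import Literature.NumberTheory.GaloisRepresentations.LocalHOneRamifiedClassOfFrobeniusEigenvector
import Literature.NumberTheory.EllipticCurves.CastellaHsuKunduLeeLiu2025.SignedBipartiteEulerSystem
import Literature.NumberTheory.GaloisRepresentations.DecompositionGroupOfCompletion
import Literature.NumberTheory.GaloisRepresentations.DecompositionGroupRelSlim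
import Literature.NumberTheory.GaloisRepresentations.LocalGaloisGroupFrobeniusProofs
import Literature.NumberTheory.GaloisRepresentations.AbsGaloisGroupCompact
import Literature.NumberTheory.Automorphic.AdicCompletionLocalField
import Literature.NumberTheory.GaloisCohomology.Howard2004.FiniteSingularTame
import Literature.NumberTheory.GaloisCohomology.Howard2004.InertTransverseDecompositionProofs
import Literature.AnabelianGeometry.AbsoluteAnabelian.NeukirchUchidaLocalInvariants
import Literature.NumberTheory.EllipticCurves.GeomPointsGaloisModule
import Literature.NumberTheory.EllipticCurves.SubgroupSelmerCocycleCriteriaProofs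
import Literature.NumberTheory.EllipticCurves.AnticyclotomicInertPrimeTotallySplitProofs
import Literature.NumberTheory.EllipticCurves.AnticyclotomicPrimeDecompositionAboveProofs
import Literature.NumberTheory.EllipticCurves.KummerMap
import HarnessLib

/-!
# Line `admdef` (crux `AnticyclotomicEisensteinDivisibility`, stmt-BirchSwinnertonDyer-20727), rigidity road (M2), part 3:
# THE ORDINARY LINE AT AN ADMISSIBLE PRIME IS NON-ZERO — `ordLine 𝔓₀ ≠ ⊥` in CHKLL25's currency, and the edge `n — nq` of
# Howard's rigidity read both ways WITHOUT the local witness hypothesis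

LEAD seat bsd-line-sbc-p1 (gen 27), `--supports stmt-BirchSwinnertonDyer-20727` (helper; OFF the v23 composition path, item (M2) of
the rigidity road map `Lines/admdef-lead-g25.md` §4).  `…AdmdefBipartitePropagation` (LEAD g25) proved the converse of the FIRST
reciprocity law of a signed bipartite system — «`λ_1(n)(0) ∈ ℤ_pˣ ⟹ ordLoc_𝔓(κ_1(nq))_0(0) ≠ 0`» — GIVEN a non-zero element `w` of
the ordinary line `ordLine 𝔓 = im (H¹(D_𝔓 ∩ Gal(K̄/K_∞), E[p]) → H¹(I_𝔓 ∩ Gal(K̄/K_∞), E[p]))` ([Howard2006] Lem. 2.2.1: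
`H¹_ord(K_𝔮, E[p]) ≅ 𝔽_p`).  THIS FILE CONSTRUCTS `w` at the prime `𝔓₀ = adicCompletionPrime K v` of `K̄` over the place
`v ∋ q` cut out by the chosen embedding `K̄ → K̄_v`, for `q` Bertolini–Darmon `1`-admissible and `[K : ℚ] = 2`:

* `exists_mem_ordLine_ne_zero` — if `I_{𝔓₀} ≤ ker κ` then `∃ w ∈ ordLine (E/K) p κ 1 𝔓₀, w ≠ 0`.  PROOF: `E[p]|_{Γ_{K_v}}` is
  unramified with a `q²`-eigenvector `P ≠ 0` of every arithmetic Frobenius at `𝔓₀` (part 1, `…AdmdefAdmissibleEigenline`), so the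
  local theorem (part 2, `Literature/…/LocalHOneRamifiedClassOfFrobeniusEigenvector`) gives a continuous cocycle `ξ` of `Γ_{K_v}` with
  `ξ(σ₀) = P` at a tame `p`-generator `σ₀ ∈ I_{K_v}`; transport `ξ` along the inverse of the closed embedding `res : Γ_{K_v} → Γ_K`
  (image `D_{𝔓₀}`, `decompositionSubgroup_adicCompletionPrime_eq_range`; `res(I_{K_v}) = I_{𝔓₀}`, `inertia_adicCompletionPrime_eq_map_absInertia`)
  to a class `z ∈ H¹(D_{𝔓₀} ∩ ker κ, E[p])`; its restriction `w` to `I_{𝔓₀} ∩ ker κ` lies in `ordLine 𝔓₀` by definition and is non-zero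
  because the cocycle takes the value `P ≠ 0` at `res σ₀ ∈ I_{𝔓₀} ≤ ker κ` while inertia acts trivially on `E[p]`.
* `exists_mem_ordLine_ne_zero_of_isAnticyclotomic` — the hypothesis `I_{𝔓₀} ≤ ker κ` DISCHARGED for `K` imaginary quadratic and `κ`
  anticyclotomic (`q` inert: `D_v ≤ ker κ`, tree `ZpExtension.decomp_le_kerSubgroup_of_span_natCast`).
* `isUnit_lam_iff_ordLoc_kappa_ne_zero_adicCompletionPrime` — PAYOFF: the edge `n — nq` of a signed bipartite system at level
  `N = N_E` read both ways at `𝔓₀`, «`λ_1(n)(0) ∈ ℤ_pˣ ⟺ ordLoc_{𝔓₀}(κ_1(nq))_0(0) ≠ 0`», with NO local witness hypothesis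
  (g25's `isUnit_lam_iff_ordLoc_kappa_ne_zero` ∘ this file); and the ascent step `kappa_mul_layer_zero_ne_zero_of_isUnit_lam_adicCompletionPrime`.

HONEST FRAMING: theorems only (no definition, no named fact, no `sorry`); kernel Galois cohomology over the tree's predicates.  The result
is stated at the chosen prime `𝔓₀` over `v` (every prime over `v` is a `Γ_K`-conjugate of it; the conjugate statement is not needed by
the line and is not proved here).  Nothing about the crux, the anchors (K1), or BSD is asserted.

References: [cite: Howard2006, Lem. 2.2.1, Lem. 2.3.4, Thm. 3.2.3] [cite: CastellaEtAl2025, Thm. 7.4 first law (arXiv:2308.10474v2 p0030 L46–L49)]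
[cite: Rubin2000, Lemma 1.3.2] [cite: NeukirchANT1999, Ch. II §9 Prop. (9.6)] [cite: BertoliniDarmon2005, p. 18].
-/

-- D-0017: single-problem summit, the namespace repeats the problem name by design.
set_option linter.dupNamespace false
set_option autoImplicit false

noncomputable section

open scoped Classical NumberField

namespace Summit.BirchSwinnertonDyer.BirchSwinnertonDyer.Theorems.SignedBaseChangeAcDivAdmdefOrdLineNonzero

open WeierstrassCurve NumberField IsDedekindDomain Field Topology
open Literature.NumberTheory.EllipticCurves Literature.NumberTheory.GaloisRepresentations
open Literature.NumberTheory.GaloisRepresentations.IsNonarchimedeanLocalField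
open Literature.NumberTheory.EllipticCurves.CastellaHsuKunduLeeLiu2025
open Literature.NumberTheory.EllipticCurves.BertoliniDarmon2005
open Literature.NumberTheory.GaloisCohomology.Howard2004
open Literature.AnabelianGeometry.AbsoluteAnabelian
open Summit.BirchSwinnertonDyer.BirchSwinnertonDyer.Theorems.SignedBaseChangeAcDivAdmdefAdmissibleEigenline
open Summit.BirchSwinnertonDyer.BirchSwinnertonDyer.Theorems.SignedBaseChangeAcDivAdmdefBipartitePropagation

universe u

section OrdLine

variable (W : WeierstrassCurve ℚ) [W.IsElliptic] [W.IsGloballyMinimal] (K : Type) [Field K] [NumberField K]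

/-- A place containing the inert rational prime `q` IS `(q)`. [folklore] -/
private theorem asIdeal_eq_span_of_mem {q : ℕ} (hq0 : q ≠ 0) (hqP : (Ideal.span {((q : ℕ) : 𝓞 K)}).IsPrime)
    (v : HeightOneSpectrum (𝓞 K)) (hqv : (q : 𝓞 K) ∈ v.asIdeal) : v.asIdeal = Ideal.span {((q : ℕ) : 𝓞 K)} := by
  -- adapted from Theorems/SignedBaseChangeAnticyclotomicEisensteinDivisibilityAdmdefRootZero.lean §1
  have hbot : Ideal.span {((q : ℕ) : 𝓞 K)} ≠ ⊥ := by
    rw [Ne, Ideal.span_singleton_eq_bot]; exact_mod_cast hq0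
  exact ((hqP.isMaximal hbot).eq_of_le v.isPrime.ne_top ((Ideal.span_singleton_le_iff_mem _).mpr hqv)).symm

/-- **Transport of a continuous cocycle along a partial inverse of restriction.**  `Γ = Γ_K` acting on a discrete `M`,
`τ` a continuous representation of a topological group `G` on `M`, `H ≤ Γ` a subgroup and `e : H →ₜ* G` a continuous homomorphism
with `τ (e x) = x` on `M` for `x ∈ H`: a continuous `1`-cocycle `ξ` of `G` pulls back to the continuous `1`-cocycle `x ↦ ξ (e x)` of `H`
(compatible pair `(e, id_M)`; written out on cochains to stay definitionally transparent). [cite: SerreGaloisCohomology1997, I §2.4] -/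
theorem exists_contOneCocycles_comp_of_apply_eq {Γ : Type} [Group Γ] [TopologicalSpace Γ] [IsTopologicalGroup Γ]
    {M : Type} [AddCommGroup M] [DistribMulAction Γ M] [TopologicalSpace M] [DiscreteTopology M]
    {G : Type} [Group G] [TopologicalSpace G] [IsTopologicalGroup G]
    (τ : ContinuousRep G ℤ M) (H : Subgroup Γ) (e : H →ₜ* G) (he : ∀ (x : H) (m : M), τ (e x) m = (x : Γ) • m)
    (ξ : contOneCocycles τ.toTopRep) :
    ∃ ζ : contOneCocycles (discreteTopRep H M), ∀ y : H, ζ.1 y = ξ.1 (e y) := by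
  refine ⟨⟨ξ.1.comp (e : C(H, G)), fun g h ↦ ?_⟩, fun _ ↦ rfl⟩
  change ξ.1 (e (g * h)) = ξ.1 (e g) + (discreteTopRep H M).ρ g (ξ.1 (e h))
  rw [map_mul, ξ.2 (e g) (e h), discreteTopRep_ρ_apply, ContinuousRep.toTopRep_ρ_apply, he]
  rfl

/-- **A continuous inverse of `res : Γ_{K_v} → Γ_K` on a subgroup of its image.**  `res` is injective
(`absGaloisRestrict_adicCompletion_injective`) and continuous from the compact `Γ_{K_v}` to the Hausdorff `Γ_K`, hence a closed
embedding; so on any subgroup `H` of `Γ_K` contained in `res(Γ_{K_v}) = D_{𝔓₀}` it has a continuous homomorphic inverse.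
[cite: NeukirchANT1999, Ch. II §9 Prop. (9.6)] -/
theorem exists_continuousMonoidHom_absGaloisRestrict_apply_eq (v : HeightOneSpectrum (𝓞 K)) (H : Subgroup (absoluteGaloisGroup K))
    (hH : H ≤ (absGaloisRestrict K (v.adicCompletion K)).toMonoidHom.range) :
    ∃ e : H →ₜ* absoluteGaloisGroup (v.adicCompletion K),
      ∀ x : H, absGaloisRestrict K (v.adicCompletion K) (e x) = (x : absoluteGaloisGroup K) := by
  have hmem : ∀ x : H, ∃ g : absoluteGaloisGroup (v.adicCompletion K),
      absGaloisRestrict K (v.adicCompletion K) g = (x : absoluteGaloisGroup K) := fun x ↦ hH x.2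
  choose e he using hmem
  have hinj := absGaloisRestrict_adicCompletion_injective K v
  haveI := absoluteGaloisGroup_compactSpace (v.adicCompletion K)
  have hce : IsClosedEmbedding (absGaloisRestrict K (v.adicCompletion K)) :=
    (absGaloisRestrict K (v.adicCompletion K)).continuous.isClosedEmbedding hinj
  have hcont : Continuous e := by
    rw [hce.toIsEmbedding.continuous_iff]
    have hcomp : (absGaloisRestrict K (v.adicCompletion K)) ∘ e = fun x : H ↦ (x : absoluteGaloisGroup K) := funext he
    rw [hcomp]
    exact continuous_subtype_val
  let e' : H →ₜ* absoluteGaloisGroup (v.adicCompletion K) :=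
    { toFun := e
      map_one' := hinj (by rw [he, map_one]; rfl)
      map_mul' := fun x y ↦ hinj (by rw [he, map_mul, he, he]; rfl)
      continuous_toFun := hcont }
  exact ⟨e', he⟩

/-- **The ordinary line at an admissible prime is non-zero** (`H¹_ord(K_𝔮, E[p]) ≠ 0`, [Howard2006] Lem. 2.2.1, in CHKLL25's
currency).  `E = W/ℚ` elliptic in global minimal form, `[K : ℚ] = 2`, `p` prime, `κ : Γ_K → ℤ_p` a `ℤ_p`-extension, `q` a
Bertolini–Darmon `1`-admissible prime for `(E, K, p)`, `v ∋ q` the place of `K` over `q`, `𝔓₀ = adicCompletionPrime K v` the prime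
of `\bar ℤ_K` over `v` cut out by the chosen embedding `K̄ → K̄_v`.  If the inertia group `I_{𝔓₀}` lies in `ker κ = Gal(K̄/K_∞)` (true
for every `ℤ_p`-extension as `v ∤ p`; discharged below for anticyclotomic `κ`), then the ordinary line
`ordLine (E/K) p κ 1 𝔓₀ ⊆ H¹(I_{𝔓₀} ∩ ker κ, E[p])` — the range of restriction from `H¹(D_{𝔓₀} ∩ ker κ, E[p])` — contains a
NON-ZERO element.  (Construction in the module docstring: the ramified local cocycle of part 2 for `E[p]|_{Γ_{K_v}} ≅ 𝔽_p ⊕ μ_p`,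
transported along `Γ_{K_v} ≅ D_{𝔓₀}`.) [cite: Howard2006, Lem. 2.2.1] [cite: Rubin2000, Lemma 1.3.2]
[cite: NeukirchANT1999, Ch. II §9 Prop. (9.6)] -/
theorem exists_mem_ordLine_ne_zero (hK2 : Module.finrank ℚ K = 2) {p : ℕ} [Fact p.Prime] (κ : ZpExtension K p)
    {q : ℕ} (hq : IsAdmissiblePrime (W.conductorNorm ℤ) K (fun ℓ ↦ W.frobeniusTrace ℓ) p 1 q)
    (v : HeightOneSpectrum (𝓞 K)) (hqv : (q : 𝓞 K) ∈ v.asIdeal)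
    (hI : (adicCompletionPrime K v).inertia (absoluteGaloisGroup K) ≤ κ.kerSubgroup) :
    ∃ w ∈ ordLine (W.baseChange K) p κ 1 (adicCompletionPrime K v), w ≠ 0 := by
  classical
  have hp : p.Prime := Fact.out
  have hq' := hq
  obtain ⟨hqprime, hqpN, hinert, -, -⟩ := hq'
  have hqp : q ≠ p := by
    rintro rfl
    exact hqpN (dvd_mul_right q _)
  have h𝔓 : adicCompletionPrime K v ∈ v.primesAbove := adicCompletionPrime_mem_primesAbove K v
  -- (1) `E[p]` at `𝔓₀`: a `q²`-eigenvector of every Frobenius, inertia acts trivially (part 1)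
  obtain ⟨P, hP0, hPfrob, hPI⟩ := exists_eigenvector_sq_forall_isArithFrobAt_level W K hK2 hq v hqv h𝔓
    (n := (p : ℤ) ^ 1) (pow_one _)
  -- (2) the local representation `τ = E[p]|_{Γ_{K_v}}` and the hypotheses of the local theorem (part 2)
  let τ : ContinuousRep (absoluteGaloisGroup (v.adicCompletion K)) ℤ (geomTorsion (W.baseChange K) ((p : ℤ) ^ 1)) :=
    ((W.baseChange K).torsionGaloisModule ((p : ℤ) ^ 1)).restrict (absGaloisRestrict K (v.adicCompletion K))
  have hτapp : ∀ (g : absoluteGaloisGroup (v.adicCompletion K)) (m : geomTorsion (W.baseChange K) ((p : ℤ) ^ 1)),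
      τ g m = absGaloisRestrict K (v.adicCompletion K) g • m := fun _ _ ↦ rfl
  have hchar := NeukirchUchidaProof.ringChar_residueField_adicCompletion v hqprime hqv
  have hB : ∀ b : geomTorsion (W.baseChange K) ((p : ℤ) ^ 1), ∃ k : ℕ, p ^ k • b = 0 := fun b ↦ ⟨1, by
    apply Subtype.ext
    have hb : ((p : ℤ) ^ 1) • (b : geomPoints (W.baseChange K)) = 0 := (mem_geomTorsion_iff (W.baseChange K) _ _).mp b.2
    rw [AddSubgroupClass.coe_nsmul, ZeroMemClass.coe_zero, ← natCast_zsmul]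
    push_cast
    exact hb⟩
  have hcard : Nat.card (geomTorsion (W.baseChange K) ((p : ℤ) ^ 1)) = p ^ 2 := by
    rw [pow_one]
    exact card_torsionPoints_eq_sq_holds (W.baseChange K) (AlgebraicClosure K) (n := p) (by exact_mod_cast hp.ne_zero)
  haveI : Finite (geomTorsion (W.baseChange K) ((p : ℤ) ^ 1)) :=
    Nat.finite_of_card_ne_zero (by rw [hcard]; exact pow_ne_zero 2 hp.ne_zero)
  have hunr : ∀ σ ∈ absInertia (v.adicCompletion K), ∀ b : geomTorsion (W.baseChange K) ((p : ℤ) ^ 1), τ σ b = b :=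
    fun σ hσ b ↦ by
      rw [hτapp]
      refine hPI _ ?_ b
      rw [inertia_adicCompletionPrime_eq_map_absInertia]
      exact Subgroup.mem_map_of_mem _ hσ
  obtain ⟨φ, hφ⟩ := exists_isAbsArithFrob_holds (F := v.adicCompletion K)
  have hφK : IsArithFrobAt (𝓞 K) (absGaloisRestrict K (v.adicCompletion K) φ) (adicCompletionPrime K v) :=
    (isArithFrobAt_absGaloisRestrict_adicCompletionPrime_iff K v (residueFieldCard_adicCompletion_eq_natCard v) φ).mpr hφ
  have hqF : residueFieldCard (v.adicCompletion K) = q ^ 2 :=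
    residueFieldCard_adicCompletion_eq_sq_of_inert hK2 hqprime hinert hqv
  have heig : τ φ P = residueFieldCard (v.adicCompletion K) • P := by
    rw [hτapp, hPfrob _ hφK, hqF, ← natCast_zsmul]
    push_cast
    rfl
  obtain ⟨ξ, σ₀, hξ⟩ : ∃ (ξ : contOneCocycles τ.toTopRep) (σ₀ : absInertia (v.adicCompletion K)), ξ.1 σ₀ = P := by
    refine exists_contOneCocycles_apply_absInertia_eq_of_frob_eigenvector (v.adicCompletion K) τ (p := p) ?_ hB ?_
      hunr hφ heig
    · rw [hchar]; exact hqp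
    · rw [hcard, hchar]
      exact ((Nat.coprime_primes hp hqprime).mpr hqp.symm).pow_left 2
  -- (3) the inverse of `res : Γ_{K_v} → Γ_K` on `H = D_{𝔓₀} ∩ ker κ`, and the transported cocycle
  have hinj := absGaloisRestrict_adicCompletion_injective K v
  set H : Subgroup (absoluteGaloisGroup K) :=
    (adicCompletionPrime K v).decompositionSubgroup (absoluteGaloisGroup K) ⊓ κ.kerSubgroup with hHdef
  have hH : H ≤ (absGaloisRestrict K (v.adicCompletion K)).toMonoidHom.range := by
    rw [← decompositionSubgroup_adicCompletionPrime_eq_range]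
    exact inf_le_left
  obtain ⟨eh, heh⟩ := exists_continuousMonoidHom_absGaloisRestrict_apply_eq K v H hH
  obtain ⟨ζ, hζapp⟩ := exists_contOneCocycles_comp_of_apply_eq τ H eh (fun x m ↦ by rw [hτapp, heh]) ξ
  set z : subgroupH1 H (geomTorsion (W.baseChange K) ((p : ℤ) ^ 1)) := oneCocycleClass _ ζ with hzdef
  have hle : (adicCompletionPrime K v).inertia (absoluteGaloisGroup K) ⊓ κ.kerSubgroup ≤ H :=
    inf_le_inf_right κ.kerSubgroup ((adicCompletionPrime K v).inertia_le_decompositionSubgroup (absoluteGaloisGroup K))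
  refine ⟨resOfLe (geomTorsion (W.baseChange K) ((p : ℤ) ^ 1)) hle z, ⟨z, rfl⟩, fun h0 ↦ hP0 ?_⟩
  -- (5) if the restriction vanished, the cocycle would vanish at `res σ₀ ∈ I_{𝔓₀} ≤ ker κ` (inertia acts trivially on `E[p]`)
  obtain ⟨a, ha⟩ := (CocycleCriteria.resOfLe_oneCocycleClass_eq_zero_iff hle ζ).mp h0
  have hσ₀I : absGaloisRestrict K (v.adicCompletion K) σ₀ ∈ (adicCompletionPrime K v).inertia (absoluteGaloisGroup K) := by
    rw [inertia_adicCompletionPrime_eq_map_absInertia]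
    exact Subgroup.mem_map_of_mem _ σ₀.2
  let s₀ : ↥((adicCompletionPrime K v).inertia (absoluteGaloisGroup K) ⊓ κ.kerSubgroup) :=
    ⟨absGaloisRestrict K (v.adicCompletion K) σ₀, hσ₀I, hI hσ₀I⟩
  have h1 := ha s₀
  have h2 : ((s₀ : absoluteGaloisGroup K) • a : geomTorsion (W.baseChange K) ((p : ℤ) ^ 1)) = a := hPI _ hσ₀I a
  rw [h2, sub_self, hζapp] at h1
  have h3 : eh (Subgroup.inclusion hle s₀) = (σ₀ : absoluteGaloisGroup (v.adicCompletion K)) :=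
    hinj (by rw [heh]; rfl)
  rw [h3, hξ] at h1
  exact h1

/-- **The same with the hypothesis `I_{𝔓₀} ≤ ker κ` DISCHARGED for the anticyclotomic tower**: `K` imaginary quadratic, `κ`
anticyclotomic, `q` BD-admissible (inert, `q ≠ p`) ⟹ `D_v ≤ ker κ` (`ZpExtension.decomp_le_kerSubgroup_of_span_natCast`) `⊇ I_{𝔓₀}`
(`inertia_adicCompletionPrime_le_decomp`), hence `∃ w ∈ ordLine (E/K) p κ 1 𝔓₀, w ≠ 0`. [cite: Howard2006, Lem. 2.2.1]
[cite: CastellaEtAl2025, §7.2 (arXiv:2308.10474v2 p0030 L24–L27)] -/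
theorem exists_mem_ordLine_ne_zero_of_isAnticyclotomic (hK : IsImaginaryQuadratic K) {p : ℕ} [Fact p.Prime]
    (κ : ZpExtension K p) (hκ : κ.IsAnticyclotomic)
    {q : ℕ} (hq : IsAdmissiblePrime (W.conductorNorm ℤ) K (fun ℓ ↦ W.frobeniusTrace ℓ) p 1 q)
    (v : HeightOneSpectrum (𝓞 K)) (hqv : (q : 𝓞 K) ∈ v.asIdeal) :
    ∃ w ∈ ordLine (W.baseChange K) p κ 1 (adicCompletionPrime K v), w ≠ 0 := by
  have hq' := hq
  obtain ⟨hqprime, -, hinert, -, -⟩ := hq'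
  obtain ⟨-, hpv⟩ := AdditiveKoly.hasGoodReductionAt_of_isAdmissiblePrime W K hq v hqv
  have hpv' : ((p : ℕ) : 𝓞 K) ∉ v.asIdeal := by rw [← Int.cast_natCast]; exact hpv
  have hspan : v.asIdeal = Ideal.span {((q : ℕ) : 𝓞 K)} := asIdeal_eq_span_of_mem K hqprime.ne_zero hinert v hqv
  refine exists_mem_ordLine_ne_zero W K hK.1 κ hq v hqv ?_
  exact (ZpExtension.inertia_adicCompletionPrime_le_decomp v).trans (ZpExtension.decomp_le_kerSubgroup_of_span_natCast (κ := κ) hK hκ hpv' hspan)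

end OrdLine

/-! ## Payoff: the edge `n — nq` of Howard's rigidity read both ways at `𝔓₀`, no local witness hypothesis -/

section Edge

variable {K : Type} [Field K] [NumberField K] {W : WeierstrassCurve ℚ} [W.IsElliptic] [W.IsGloballyMinimal] {p : ℕ} [Fact p.Prime]
  {κ : ZpExtension K p} {γ : absoluteGaloisGroup K} {N : ℕ} {ε : ℤˣ} {B : SignedBipartiteSystem W K p κ}

/-- **`λ_1(n)(0) ∈ ℤ_pˣ ⟺ ordLoc_{𝔓₀}(κ_1(nq))_0(0) ≠ 0`** for a signed bipartite system at level `N = N_E` over an imaginary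
quadratic `K` with anticyclotomic `κ`, `nq ∈ 𝒩_1^ind`, `q` `1`-admissible not dividing `n`, at the chosen prime `𝔓₀` over the place
`v ∋ q`: LEAD g25's `isUnit_lam_iff_ordLoc_kappa_ne_zero` with its local witness supplied by `exists_mem_ordLine_ne_zero_of_isAnticyclotomic`.
Howard's dichotomy at the indefinite vertex `nq` adjacent to `n`, modulo `𝔪 = (p, T)`. [cite: Howard2006, Lem. 2.3.4, Thm. 3.2.3 (c)]
[cite: CastellaEtAl2025, Thm. 7.4 first law (arXiv:2308.10474v2 p0030 L46–L49)] -/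
theorem isUnit_lam_iff_ordLoc_kappa_ne_zero_adicCompletionPrime (hB : IsSignedBipartiteSystem W K p κ γ N ε B)
    (hN : (N : ℤ) = W.conductorNorm ℤ) (hK : IsImaginaryQuadratic K) (hκ : κ.IsAnticyclotomic) {n q : ℕ}
    (hnq : n * q ∈ indefProducts N K (fun ℓ ↦ W.frobeniusTrace ℓ) p 1)
    (hq : IsAdmissiblePrime N K (fun ℓ ↦ W.frobeniusTrace ℓ) p 1 q) (hqn : ¬ q ∣ n)
    {v : HeightOneSpectrum (𝓞 K)} (hv : ((q : ℕ) : 𝓞 K) ∈ v.asIdeal) :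
    IsUnit (PowerSeries.constantCoeff (B.lam 1 n)) ↔
      ordLoc (W.baseChange K) p κ γ 1 (adicCompletionPrime K v) (B.kappa 1 (n * q)) 0 0 ≠ 0 := by
  have hN' : N = W.conductorNorm ℤ := by exact_mod_cast hN
  have hqE : IsAdmissiblePrime (W.conductorNorm ℤ) K (fun ℓ ↦ W.frobeniusTrace ℓ) p 1 q := hN' ▸ hq
  obtain ⟨w, hw, hw0⟩ := exists_mem_ordLine_ne_zero_of_isAnticyclotomic W K hK κ hκ hqE v hv
  exact isUnit_lam_iff_ordLoc_kappa_ne_zero hB hnq hq hqn hv (adicCompletionPrime_mem_primesAbove K v) hw hw0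

/-- **Howard's ascent step at `𝔓₀`, witness-free: a unit `λ_1(n)(0)` makes the bottom class `κ_1(nq)_0 ∈ H¹(K, E[p])` NON-ZERO**
(LEAD g25's `kappa_mul_layer_zero_ne_zero_of_isUnit_lam` with the local witness supplied). [cite: Howard2006, Lem. 2.3.4, Thm. 3.2.3]
[cite: BurungaleCastellaKim2021, arXiv:1908.09512 Lem. 7.3] -/
theorem kappa_mul_layer_zero_ne_zero_of_isUnit_lam_adicCompletionPrime (hB : IsSignedBipartiteSystem W K p κ γ N ε B)
    (hN : (N : ℤ) = W.conductorNorm ℤ) (hK : IsImaginaryQuadratic K) (hκ : κ.IsAnticyclotomic) {n q : ℕ}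
    (hnq : n * q ∈ indefProducts N K (fun ℓ ↦ W.frobeniusTrace ℓ) p 1)
    (hq : IsAdmissiblePrime N K (fun ℓ ↦ W.frobeniusTrace ℓ) p 1 q) (hqn : ¬ q ∣ n)
    {v : HeightOneSpectrum (𝓞 K)} (hv : ((q : ℕ) : 𝓞 K) ∈ v.asIdeal)
    (hlam : IsUnit (PowerSeries.constantCoeff (B.lam 1 n))) : B.kappa 1 (n * q) 0 ≠ 0 := by
  have hN' : N = W.conductorNorm ℤ := by exact_mod_cast hN
  have hqE : IsAdmissiblePrime (W.conductorNorm ℤ) K (fun ℓ ↦ W.frobeniusTrace ℓ) p 1 q := hN' ▸ hq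
  obtain ⟨w, hw, hw0⟩ := exists_mem_ordLine_ne_zero_of_isAnticyclotomic W K hK κ hκ hqE v hv
  exact kappa_mul_layer_zero_ne_zero_of_isUnit_lam hB hnq hq hqn hv (adicCompletionPrime_mem_primesAbove K v) hw hw0 hlam

end Edge

end Summit.BirchSwinnertonDyer.BirchSwinnertonDyer.Theorems.SignedBaseChangeAcDivAdmdefOrdLineNonzero

end
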